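import Literature.Analysis.FluidPDE.MVSliceIntegrability
import HarnessLib

/-!
# The minimum principle for the entropy of a dissipative measure-valued solution (BF Lemma 2.5)

Testing the renormalised entropy inequality (BF (2.27), field `entropy` of
`DissipativeMVEuler.IsDissipativeMVSolution`) with the constant test function `φ ≡ 1` and the
non-positive cut-off `Z₋(s) = max(min(s - a, 0), -1)` shows: if the initial datum is the Dirac
mass at a classical state whose entropy is `≥ a` everywhere, then for a.e. `τ ∈ (0,T)`, a.e. `x`
and `Y_{τ,x}`-a.e. state `(ρ, E, m)` one has `s(ρ, E) ≥ a` (`ae_entropy_ge`). Consequently the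
relative energy without cut-off is dominated by the one with the cut-off `clamp a b`
(`ae_relEnergyFull_le_relEnergyZ`), BF §3.1.1 ("in view of (2.31) we may assume `ℰ ≤ ℰ_Z`").

## References

* J. Březina, E. Feireisl, J. Math. Soc. Japan 70 (2018), Lemma 2.5, (2.31), §3.1.1.
-/

noncomputable section

open Set Function MeasureTheory ProbabilityTheory Filter
open scoped BigOperators ENNReal Topology InnerProductSpace

namespace Literature.Analysis.FluidPDE

namespace CompressibleEuler

open Literature.Analysis.FunctionSpaces EulerPhase StrongPointData EulerEOS
open Literature.Analysis.FunctionSpaces.Torus hiding kineticEnergy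

variable {eos : EulerEOS} {T T₁ : ℝ} {ρ : ℝ → UnitAddTorus (Fin 3) → ℝ}
  {u : ℝ → UnitAddTorus (Fin 3) → EuclideanSpace ℝ (Fin 3)} {ϑ : ℝ → UnitAddTorus (Fin 3) → ℝ}
  {Y : Kernel (ℝ × UnitAddTorus (Fin 3)) EulerPhase} {D : ℝ → ℝ}

/-! ## The minimum principle -/

/-- **Minimum principle for the entropy (BF Lemma 2.5 / (2.31))**: with Dirac initial data at a
classical state of entropy `≥ a`, `s(ρ,E) ≥ a` holds `Y_{τ,x}`-a.e. for a.e. `(τ, x)`.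
[cite: BrezinaFeireisl2018, Lemma 2.5] -/
theorem ae_entropy_ge (hG : eos.IsGibbs) (hS : eos.IsThermodynamicallyStable)
    (htemp : ∀ r E : ℝ, 0 < r → 0 < E →
      0 < eos.temperature r E ∧ r * eos.e r (eos.temperature r E) = E)
    (h : IsClassicalEulerSolution eos T₁ ρ u ϑ) (hT : 0 < T) (hTT₁ : T < T₁)
    (hMV : IsDissipativeMVSolution eos.toConservative T Y D)
    (hsupp : ∀ z, ∀ᵐ w ∂(Y z), w ∈ phaseQuadrant)
    (hY0 : ∀ᵐ x ∂(volume : Measure (UnitAddTorus (Fin 3))),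
      Y (0, x) = Measure.dirac (classicalState eos ρ u ϑ 0 x))
    {a : ℝ} (ha : ∀ x, a ≤ eos.s (ρ 0 x) (ϑ 0 x)) :
    ∀ᵐ τ ∂(volume.restrict (Ioo 0 T)), ∀ᵐ x ∂(volume : Measure (UnitAddTorus (Fin 3))),
      ∀ᵐ w ∂(Y (τ, x)), a ≤ eos.s (dens w) (stateTemp eos (dens w) (ien w)) := by
  haveI := hMV.markov
  have hZ := isEntropyCutoff_lowerCutoff a
  have hent := hMV.entropy (fun _ _ => (1 : ℝ)) isTestFunction_one (fun _ _ _ => zero_le_one)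
    (lowerCutoff a) hZ
  obtain ⟨C, hC, hmomb⟩ := hMV.moment_bound
  have wZS : ContinuousOn (fun w : EulerPhase =>
      lowerCutoff a (eos.s (dens w) (stateTemp eos (dens w) (ien w)))) phaseQuadrant :=
    hZ.1.comp_continuousOn (continuousOn_stateEntropy hG hS htemp)
  have cg : ContinuousOn (fun q : (ℝ × UnitAddTorus (Fin 3)) × EulerPhase =>
      dens q.2 * lowerCutoff a (eos.s (dens q.2) (stateTemp eos (dens q.2) (ien q.2)))) (goodSet T₁) :=
    (liftW continuous_dens.continuousOn).mul (liftW wZS)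
  -- the initial term vanishes
  have h0T₁ : (0 : ℝ) ∈ Ico 0 T₁ := ⟨le_rfl, hT.trans hTT₁⟩
  have hinit : ∫ x, Young.avg Y (fun w => dens w *
      lowerCutoff a (eos.toConservative.entropy (dens w) (ien w))) 0 x * (1 : ℝ) = 0 := by
    refine integral_eq_zero_of_ae ?_
    filter_upwards [hY0] with x hx
    have hr : 0 < ρ 0 x := h.density_pos 0 h0T₁ x
    have hθ : 0 < ϑ 0 x := h.temperature_pos 0 h0T₁ x
    simp only [Young.avg, hx, integral_dirac, mul_one, Pi.zero_apply]
    show ρ 0 x * lowerCutoff a (eos.s (ρ 0 x) (eos.temperature (ρ 0 x) (ρ 0 x * eos.e (ρ 0 x) (ϑ 0 x)))) = 0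
    rw [eos.temperature_energy _ _ hr hθ, lowerCutoff_eq_zero_iff.2 (ha x), mul_zero]
  filter_upwards [hent, hmomb, ae_restrict_mem measurableSet_Ioo] with τ e1 e5 hτ
  have hτ₁ : τ ∈ Ioo 0 T₁ := ⟨hτ.1, hτ.2.trans hTT₁⟩
  -- the left-hand side of the entropy inequality vanishes for `φ ≡ 1`
  have hlhs : ∫ z in Ioo 0 τ ×ˢ univ,
      (Young.avg Y (fun w => dens w * lowerCutoff a (eos.toConservative.entropy (dens w) (ien w))) z.1 z.2 *
          timeDeriv (fun (_ : ℝ) (_ : UnitAddTorus (Fin 3)) => (1 : ℝ)) z.1 z.2 +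
        ⟪Young.vavg Y (fun w => lowerCutoff a (eos.toConservative.entropy (dens w) (ien w)) • mom w) z.1 z.2,
          Torus.gradient (fun _ : UnitAddTorus (Fin 3) => (1 : ℝ)) z.2⟫_ℝ) = 0 := by
    refine integral_eq_zero_of_ae (Eventually.of_forall fun z => ?_)
    simp [timeDeriv_one, gradient_one]
  rw [hlhs, hinit, sub_zero] at e1
  simp only [mul_one] at e1
  -- `g(x) = ⟨Y_{τ,x}; ρ Z₋(s)⟩ ≤ 0` is integrable with nonnegative integral, hence `0` a.e.
  set g : UnitAddTorus (Fin 3) → ℝ := fun x =>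
    ∫ w, dens w * lowerCutoff a (eos.s (dens w) (stateTemp eos (dens w) (ien w))) ∂(Y (τ, x)) with hg
  have hgeq : (fun x => Young.avg Y (fun w => dens w *
      lowerCutoff a (eos.toConservative.entropy (dens w) (ien w))) τ x) = g := by
    funext x; rfl
  rw [hgeq] at e1
  have i := slice_integrable hG hS htemp hsupp hτ₁ hC e5 cg (A := 1) (B := 0) zero_le_one le_rfl
    fun x w hw => by
      rw [abs_mul, abs_of_pos hw.1, one_mul, add_zero]
      calc dens w * |lowerCutoff a (eos.s (dens w) (stateTemp eos (dens w) (ien w)))| ≤ dens w * 1 :=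
            mul_le_mul_of_nonneg_left (abs_lowerCutoff_le _ _) hw.1.le
        _ ≤ momentFun eos.toConservative w := by rw [mul_one]; exact dens_le_momentFun hw
  have hgi : Integrable g volume := i.2.1
  have hg_nonpos : ∀ x, g x ≤ 0 := fun x =>
    integral_nonpos_of_ae ((hsupp (τ, x)).mono fun w hw => mul_nonpos_iff.2 (Or.inl ⟨hw.1.le, lowerCutoff_nonpos _ _⟩))
  have hneg : ∫ x, -g x = 0 := by
    rw [integral_neg]
    have := integral_nonpos_of_ae (μ := (volume : Measure (UnitAddTorus (Fin 3))))
      (Eventually.of_forall hg_nonpos : (fun x => g x) ≤ᵐ[volume] 0)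
    linarith
  have hgae : ∀ᵐ x ∂(volume : Measure (UnitAddTorus (Fin 3))), g x = 0 := by
    have hneg' : ∫ x, (-g) x = 0 := hneg
    have := (integral_eq_zero_iff_of_nonneg_ae (Eventually.of_forall fun x => by
      simp only [Pi.zero_apply, Pi.neg_apply]; linarith [hg_nonpos x]) hgi.neg).1 hneg'
    filter_upwards [this] with x hx
    simp only [Pi.neg_apply, Pi.zero_apply, neg_eq_zero] at hx
    exact hx
  filter_upwards [hgae, i.1] with x hx hix
  -- on the fibre: a non-positive integrable function with zero integral vanishes a.e.
  have hfi : Integrable (fun w => -(dens w * lowerCutoff a (eos.s (dens w) (stateTemp eos (dens w) (ien w)))))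
      (Y (τ, x)) := hix.neg
  have hf0 : 0 ≤ᵐ[Y (τ, x)] fun w => -(dens w * lowerCutoff a (eos.s (dens w) (stateTemp eos (dens w) (ien w)))) :=
    (hsupp (τ, x)).mono fun w hw => by
      simp only [Pi.zero_apply, Left.nonneg_neg_iff]
      exact mul_nonpos_iff.2 (Or.inl ⟨hw.1.le, lowerCutoff_nonpos _ _⟩)
  have hint0 : ∫ w, -(dens w * lowerCutoff a (eos.s (dens w) (stateTemp eos (dens w) (ien w)))) ∂(Y (τ, x)) = 0 := by
    rw [integral_neg, neg_eq_zero]; exact hx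
  have hae := (integral_eq_zero_iff_of_nonneg_ae hf0 hfi).1 hint0
  filter_upwards [hae, hsupp (τ, x)] with w hw hwq
  simp only [Pi.zero_apply, neg_eq_zero] at hw
  rcases mul_eq_zero.1 hw with h1 | h1
  · exact absurd h1 hwq.1.ne'
  · exact lowerCutoff_eq_zero_iff.1 h1

/-- **`ℰ ≤ ℰ_Z` almost everywhere** for the cut-off `clamp a b` once `s ≥ a` holds a.e.
(`relEnergyZ = relEnergyFull + Θ ρ (s - Z(s))` and `s - clamp a b s ≥ 0` for `s ≥ a`).
[cite: BrezinaFeireisl2018, §3.1.1] -/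
theorem relEnergyFull_le_relEnergyZ_of_entropy_ge {a b : ℝ} (d : StrongPointData) (hr : 0 < d.r)
    (hΘ : 0 ≤ d.Θ) {w : EulerPhase} (hw : w ∈ phaseQuadrant)
    (hE : dens w * eos.e (dens w) (stateTemp eos (dens w) (ien w)) = ien w)
    (hs : a ≤ eos.s (dens w) (stateTemp eos (dens w) (ien w))) :
    relEnergyFull eos d (dens w) (ien w) (mom w) ≤ d.relEnergyZ eos (clamp a b) w := by
  rw [relEnergyZ_eq (clamp a b) d hr.ne' hw.1 hE]
  have h1 : 0 ≤ eos.s (dens w) (stateTemp eos (dens w) (ien w)) -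
      clamp a b (eos.s (dens w) (stateTemp eos (dens w) (ien w))) := sub_nonneg.2 (clamp_le_self hs)
  have h2 : 0 ≤ d.Θ * dens w := mul_nonneg hΘ hw.1.le
  nlinarith

end CompressibleEuler

end Literature.Analysis.FluidPDE
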